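import Summits.Ventures.CertifiedArithmetic.LowPrec.ErrorTables

/-!
# The RNE inflation asymmetry — exhaustive kernel cross-checks in FP4 / FP6

HONEST FRAMING (venture CertifiedArithmetic / cell `pub-lowprec`): certified error envelopes and
provably optimal rounding/accumulation schemes for low-precision formats under stated cost models;
every table by two implementations; no hardware or vendor claims.

`RoundNearestInflation.abs_err_lt_of_inflation` (structural, every format with `m ≥ 1`): if
round-to-nearest-even inflates a sum of two data then `|fl(a+b) - (a+b)|·(1+2u+2u²) < u·|a+b|`.
Here the same inequality is checked by KERNEL EVALUATION on every ordered pair of data of E2M1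
(`u = 1/4`), E3M2 (`u = 1/8`) and E2M3 (`u = 1/16`) — the third route next to the structural proof
and the Python brute force (`code/lean/signed_treelaw/inflation_check.py`); pairs whose sum is not
inflated (including every saturating pair) satisfy the implication vacuously.
-/

namespace Literature.ComputerArithmetic.FloatingPoint

namespace MiniFloat

open Format

/-- E2M1 (`u = 1/4`, `1 + 2u + 2u² = 13/8`): the inflation bound holds for EVERY ordered pair of
data
(exhaustive kernel evaluation; pairs whose sum saturates or is not inflated satisfy it vacuously).
[folklore] -/
theorem inflation_check_E2M1 (a b : MiniFloat Format.E2M1)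
    (hinf : |a.toRat + b.toRat| < |(roundNE Format.E2M1 (a.toRat + b.toRat)).toRat|) :
    |(roundNE Format.E2M1 (a.toRat + b.toRat)).toRat - (a.toRat + b.toRat)| * (13 / 8)
      < 1 / 4 * |a.toRat + b.toRat| := by
  have h : ((all Format.E2M1).all fun a => (all Format.E2M1).all fun b =>
      decide (|a.toRat + b.toRat| < |(roundNE Format.E2M1 (a.toRat + b.toRat)).toRat| →
        |(roundNE Format.E2M1 (a.toRat + b.toRat)).toRat - (a.toRat + b.toRat)| * (13 / 8)
          < 1 / 4 * |a.toRat + b.toRat|)) = true := by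
    decide +kernel
  have := forall₂_of_all_all h a b
  simp only [decide_eq_true_eq] at this
  exact this hinf

/-- E3M2 (`u = 1/8`, `1 + 2u + 2u² = 41/32`): the inflation bound on all `64 × 64` ordered pairs of
data (kernel). [folklore] -/
theorem inflation_check_E3M2 (a b : MiniFloat Format.E3M2)
    (hinf : |a.toRat + b.toRat| < |(roundNE Format.E3M2 (a.toRat + b.toRat)).toRat|) :
    |(roundNE Format.E3M2 (a.toRat + b.toRat)).toRat - (a.toRat + b.toRat)| * (41 / 32)
      < 1 / 8 * |a.toRat + b.toRat| := by
  have h : ((all Format.E3M2).all fun a => (all Format.E3M2).all fun b =>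
      decide (|a.toRat + b.toRat| < |(roundNE Format.E3M2 (a.toRat + b.toRat)).toRat| →
        |(roundNE Format.E3M2 (a.toRat + b.toRat)).toRat - (a.toRat + b.toRat)| * (41 / 32)
          < 1 / 8 * |a.toRat + b.toRat|)) = true := by
    decide +kernel
  have := forall₂_of_all_all h a b
  simp only [decide_eq_true_eq] at this
  exact this hinf

/-- E2M3 (`u = 1/16`, `1 + 2u + 2u² = 145/128`): the inflation bound on all `64 × 64` ordered pairs
of data (kernel). [folklore] -/
theorem inflation_check_E2M3 (a b : MiniFloat Format.E2M3)
    (hinf : |a.toRat + b.toRat| < |(roundNE Format.E2M3 (a.toRat + b.toRat)).toRat|) :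
    |(roundNE Format.E2M3 (a.toRat + b.toRat)).toRat - (a.toRat + b.toRat)| * (145 / 128)
      < 1 / 16 * |a.toRat + b.toRat| := by
  have h : ((all Format.E2M3).all fun a => (all Format.E2M3).all fun b =>
      decide (|a.toRat + b.toRat| < |(roundNE Format.E2M3 (a.toRat + b.toRat)).toRat| →
        |(roundNE Format.E2M3 (a.toRat + b.toRat)).toRat - (a.toRat + b.toRat)| * (145 / 128)
          < 1 / 16 * |a.toRat + b.toRat|)) = true := by
    decide +kernel
  have := forall₂_of_all_all h a b
  simp only [decide_eq_true_eq] at this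
  exact this hinf

end MiniFloat

end Literature.ComputerArithmetic.FloatingPoint
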